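import Literature.NumberTheory.EllipticCurves.PAdicHeightsProofs
import HarnessLib

/-!
# `WeierstrassCurve.HasSplitMultiplicativeReductionAtPrime` is a predicate, not a fact

`WeierstrassCurve.HasSplitMultiplicativeReductionAtPrime W p`
(`Literature.NumberTheory.EllipticCurves.PAdicHeights`) is a *definition*: the reduction type
"split multiplicative at the rational prime `p`" of a Weierstrass curve `W / ℚ`, i.e. Mathlib's
`WeierstrassCurve.HasSplitMultiplicativeReduction ℤ_[p]` of the `ℤ_p`-minimal model of `W / ℚ_p`
(Silverman, *AEC* VII.5, Definition and Prop. VII.5.1(b): a minimal equation has multiplicative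
reduction iff `v(Δ) > 0` and `v(c₄) = 0`, *split* iff the tangent slopes at the node lie in the
residue field). It is the companion of `HasGoodReductionAtPrime` /
`HasMultiplicativeReductionAtPrime` (`Literature.NumberTheory.EllipticCurves.Tamagawa`) and is
consumed as a hypothesis (`TateParameterData.split`, `nonempty_tateParameterData_iff`,
`QuadraticTwistPadicReduction`).

In particular it is **not** a named fact to be discharged: a declaration
`HasSplitMultiplicativeReductionAtPrime_holds : HasSplitMultiplicativeReductionAtPrime` is ill-typed,
and the universal closure `∀ W p, W.HasSplitMultiplicativeReductionAtPrime p` is false. This file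
records that, sorry-free:

* `WeierstrassCurve.hasSplitMultiplicativeReductionAtPrime_iff` — definitional unfolding;
* `WeierstrassCurve.HasSplitMultiplicativeReductionAtPrime.one_lt_norm_j` — split multiplicative
  reduction at `p` forces `‖j(E)‖_p > 1` (AEC VII.5.1(b); via the tree lemma
  `WeierstrassCurve.one_lt_norm_j_of_hasMultiplicativeReductionAtPrime`);
* `WeierstrassCurve.not_hasSplitMultiplicativeReductionAtPrime_of_norm_j_le_one` — contrapositive:
  `p`-integral `j` excludes split multiplicative reduction at `p` (cf. AEC VII.5.5);
* `Literature.NumberTheory.EllipticCurves.not_forall_hasSplitMultiplicativeReductionAtPrime` —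
  the refutation of the universal closure, witnessed by `y² = x³ + 1` (`j = 0`) at `p = 2`.

## References

* [SilvermanAEC2009] J. H. Silverman, *The Arithmetic of Elliptic Curves*, 2nd ed., GTM 106,
  Springer 2009, VII.5: Definition (good / multiplicative / additive; split), Prop. VII.5.1(b),
  Prop. VII.5.5 (p. 174–175 of the held text).
-/

noncomputable section

open scoped Classical

namespace WeierstrassCurve

variable {W : WeierstrassCurve ℚ} {p : ℕ} [Fact p.Prime]

variable (W p) in
/-- Unfolding of the definition: `W` has split multiplicative reduction at `p` iff the
`ℤ_p`-minimal model of `W / ℚ_p` has split multiplicative reduction in Mathlib's sense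
(Silverman, *AEC* VII.5, Definition). Deliberate dot-notation extension of Mathlib's
`WeierstrassCurve` namespace, like the definition itself. [folklore] -/
theorem hasSplitMultiplicativeReductionAtPrime_iff :
    W.HasSplitMultiplicativeReductionAtPrime p ↔
      ((W.baseChange ℚ_[p]).minimal ℤ_[p]).HasSplitMultiplicativeReduction ℤ_[p] :=
  Iff.rfl

/-- Split multiplicative reduction at `p` forces `‖j(E)‖_p > 1`: the minimal model has
`v(Δ) > 0`, `v(c₄) = 0`, so `v(j) = 3 v(c₄) - v(Δ) < 0` (Silverman, *AEC* Prop. VII.5.1(b); the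
multiplicative case is `WeierstrassCurve.one_lt_norm_j_of_hasMultiplicativeReductionAtPrime`).
[cite: SilvermanAEC2009, Prop. VII.5.1(b)] -/
theorem HasSplitMultiplicativeReductionAtPrime.one_lt_norm_j [W.IsElliptic]
    (h : W.HasSplitMultiplicativeReductionAtPrime p) : 1 < ‖(W.j : ℚ_[p])‖ :=
  one_lt_norm_j_of_hasMultiplicativeReductionAtPrime h.hasMultiplicativeReductionAtPrime

/-- An elliptic curve `E / ℚ` whose `j`-invariant is `p`-integral (`‖j(E)‖_p ≤ 1`) does not have
split multiplicative reduction at `p` (contrapositive of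
`HasSplitMultiplicativeReductionAtPrime.one_lt_norm_j`; cf. Silverman, *AEC* Prop. VII.5.5:
integral `j` ⇔ potential good reduction). [cite: SilvermanAEC2009, Prop. VII.5.1(b)] -/
theorem not_hasSplitMultiplicativeReductionAtPrime_of_norm_j_le_one [W.IsElliptic]
    (hj : ‖(W.j : ℚ_[p])‖ ≤ 1) : ¬ W.HasSplitMultiplicativeReductionAtPrime p :=
  fun h ↦ (not_le.mpr h.one_lt_norm_j) hj

end WeierstrassCurve

namespace Literature.NumberTheory.EllipticCurves

/-- The predicate `WeierstrassCurve.HasSplitMultiplicativeReductionAtPrime` is **not** universally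
true, so it is a definition and not a dischargeable fact: the elliptic curve `y² = x³ + 1`
(`⟨0, 0, 0, 0, 1⟩`, `Δ = -432`, `c₄ = 0`, `j = 0`) has `‖j‖₂ = 0 ≤ 1`, hence no split
multiplicative reduction at `p = 2` (indeed at no prime), by
`WeierstrassCurve.not_hasSplitMultiplicativeReductionAtPrime_of_norm_j_le_one`. [folklore] -/
theorem not_forall_hasSplitMultiplicativeReductionAtPrime :
    ¬ ∀ (W : WeierstrassCurve ℚ) (p : ℕ) [Fact p.Prime],
      W.HasSplitMultiplicativeReductionAtPrime p := by
  intro h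
  set W : WeierstrassCurve ℚ := ⟨0, 0, 0, 0, 1⟩ with hW
  haveI : W.IsElliptic := ⟨by
    rw [isUnit_iff_ne_zero]
    norm_num [hW, WeierstrassCurve.Δ, WeierstrassCurve.b₂, WeierstrassCurve.b₄,
      WeierstrassCurve.b₆, WeierstrassCurve.b₈]⟩
  have hc₄ : W.c₄ = 0 := by
    norm_num [hW, WeierstrassCurve.c₄, WeierstrassCurve.b₂, WeierstrassCurve.b₄]
  have hj : W.j = 0 := W.j_eq_zero hc₄
  exact WeierstrassCurve.not_hasSplitMultiplicativeReductionAtPrime_of_norm_j_le_one (p := 2)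
    (by simp [hj]) (h W 2)

end Literature.NumberTheory.EllipticCurves

end
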